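import Mathlib

/-!
# K\*\* — definitions (`RootDecompSegregatorSmallSegregators/Negative/Defs`)

Definitions file of the kernel refutation of the route item `RootDecompSegregator.SmallSegregators`
(stmt-PneNP-26297; deciding theorem `Summit.PneNP.PneNP.Theorems.RootDecompSegregatorSmallSegregators_refuted`
in `Theorems/RootDecompSegregatorSmallSegregatorsRefutation.lean`; proofs in the sibling files `KSS1` … of this
directory).  Contents, in dependency order: the VERBATIM sub-formulas of the item — pushdown families,
the multi-pushdown step graphs `H_r(N)` (`IsMultiPushdownGraph`), `J`-avoiding ancestors, segregators,
`ell N = log₂ N + 1`, the page dial `SmallSegregatorsAt r` (the item is `∀ r, SmallSegregatorsAt r` by `rfl`) —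
then ancestor-robust families (`AncestorRobust r c δ`), stack traces (`StackOp`) and their LIFO arcs, the
step count `dbT L = 10·2^L·L + 2·2^L`, the double reflected butterfly `DB(L)` (mirrors `dbMirror`, charged
path systems `ChargedDB`, the counting predicate `DBCount`, blocked vertices, good sets `G`, potentials), the
prefix balance `TSB.PD` of stack words, the triple-stack butterfly schedule `TSB` (block words, levels, traces
`trU`/`trX`, step coordinates `tP`/`tQ`/`tC`, births `beta`, the step graph `tbGraph`, carriers, decoding) and
the layout predicate `DBLayoutIn κ`.

PROVENANCE.  The mathematics and the Lean text of every declaration in this directory are the work of the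
decomp-pnenp cell's lens-1 lineage (work file `decomp-pnenp-lens-1/SegregatorPageThreshold.lean`,
generations 4–5, v5 sha256 `099856e2…`, brief `KSS-DoubleButterfly.md`): the dependency cone of its theorem
`not_smallSegregators`, extracted verbatim by the cell critic, definitions separated from proofs and split
into files of at most 400 lines; docstrings were added where missing and the `StackOp` equality decision is
written out by hand.  No declaration in this directory mentions a Theses item.
-/

namespace Summit.PneNP.PneNP.Theorems.RootDecompSegregatorSmallSegregators.Negative

open Relation

/-! ### Vocabulary — VERBATIM copies of the tree's PPST definitions
(`Literature.Computability.Complexity.{IsPushdownFamily, IsMultiPushdownGraph, ancestorsAvoiding,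
IsSegregator}`, `…PaulPippengerSzemerediTrotter1983Segregators.lean` ll. 68–143; that module is
olean-less on the farm snapshot, the route file N7 therefore carries them UNFOLDED; the copies below are
definitionally those unfoldings — `smallSegregators_iff_forall` is `Iff.rfl`). -/

/-- VERBATIM `IsPushdownFamily`: forward edges, in-degree ≤ 1 inside the family, no two edges cross
(GKS 1989 p. 2: "(i₁,j₁),(i₂,j₂) with i₁ < i₂ < j₁ ⟹ j₂ ≤ j₁"). -/
def IsPushdownFamily (E : Finset (ℕ × ℕ)) : Prop :=
  (∀ e ∈ E, e.1 < e.2) ∧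
  (∀ e₁ ∈ E, ∀ e₂ ∈ E, e₁.2 = e₂.2 → e₁ = e₂) ∧
  (∀ e₁ ∈ E, ∀ e₂ ∈ E, e₁.1 < e₂.1 → e₂.1 < e₁.2 → e₂.2 ≤ e₁.2)

/-- VERBATIM `IsMultiPushdownGraph`: `H_r(N)` — forward edges below `N`, covered by the successor
edges and `r` pushdown families (a subclass of the `r`-page graphs with spine of GKS 1989). -/
def IsMultiPushdownGraph (r N : ℕ) (E : Finset (ℕ × ℕ)) : Prop :=
  (∀ e ∈ E, e.1 < e.2 ∧ e.2 < N) ∧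
  ∃ F : Fin r → Finset (ℕ × ℕ), (∀ m, IsPushdownFamily (F m)) ∧
    ∀ e ∈ E, e.2 = e.1 + 1 ∨ ∃ m, e ∈ F m

/-- VERBATIM `ancestorsAvoiding`: `J`-avoiding ancestors of `v`. -/
def ancestorsAvoiding (E : Finset (ℕ × ℕ)) (J : Finset ℕ) (v : ℕ) : Set ℕ :=
  {u | TransGen (fun a b => (a, b) ∈ E ∧ a ∉ J ∧ b ∉ J) u v}

/-- VERBATIM `IsSegregator`: outside `J` every vertex `v < N` has at most `M` `J`-avoiding ancestors. -/
def IsSegregator (M : ℕ) (J : Finset ℕ) (E : Finset (ℕ × ℕ)) (N : ℕ) : Prop :=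
  ∀ v < N, v ∉ J → (ancestorsAvoiding E J v).ncard ≤ M

/-- `ℓ n = ⌊log₂ n⌋ + 1`. -/
def ell (n : ℕ) : ℕ := Nat.log 2 n + 1

/-! ### The PAGE-NUMBER DIAL of Piece A -/

/-- **`SmallSegregatorsAt r`** — Santhanam's `(o(n), o(n/log n))` segregator hypothesis for the ONE
class `H_r(N)` (`r` pushdown families + successor edges): for every `k`, every large enough
`H_r(N)`-graph has a `J` with `(k+1)·|J|·ℓN ≤ N` outside which every vertex has ≤ `N/(k+1)`
`J`-avoiding ancestors. `SmallSegregators` (route item stmt-PneNP-26297) is `∀ r, SmallSegregatorsAt r`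
(`smallSegregators_iff_forall`, `Iff.rfl`). -/
def SmallSegregatorsAt (r : ℕ) : Prop :=
  ∀ k : ℕ, ∃ N₀ : ℕ, ∀ N : ℕ, N₀ ≤ N → ∀ E : Finset (ℕ × ℕ), IsMultiPushdownGraph r N E →
    ∃ J : Finset ℕ, (k + 1) * (J.card * ell N) ≤ N ∧ IsSegregator (N / (k + 1)) J E N

/-! ### The KILL ROAD for Piece A, typed per page number: depth-robust ⟹ ancestor-robust ⟹ ¬A(r)
K** (header; graph `dbGraph` typed in the next section) delivers `AncestorRobust 3 960 24` DIRECTLY —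
ancestor mass, not depth — and then `not_smallSegregators_of_ancestorRobust` below refutes Piece A. -/

/-- VERBATIM (lens-1 g3) `AncestorRobust r c δ`: infinitely often an `H_r(N)`-graph in which every
`J` with `c·|J|·ℓN ≤ N` leaves a vertex outside `J` with more than `N/δ` `J`-avoiding ancestors. -/
def AncestorRobust (r c δ : ℕ) : Prop :=
  ∀ N₀ : ℕ, ∃ N : ℕ, N₀ ≤ N ∧ ∃ E : Finset (ℕ × ℕ), IsMultiPushdownGraph r N E ∧
    ∀ J : Finset ℕ, c * (J.card * ell N) ≤ N →
      ∃ v : ℕ, v < N ∧ v ∉ J ∧ N < δ * (ancestorsAvoiding E J v).ncard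

/-- Ancestor sets are finite (they consist of tails of edges). -/
theorem ancestorsAvoiding_subset (E : Finset (ℕ × ℕ)) (J : Finset ℕ) (v : ℕ) :
    ancestorsAvoiding E J v ⊆ ↑(E.image Prod.fst) := by
  intro u hu
  obtain ⟨b, hb, -⟩ := TransGen.head'_iff.1 hu
  exact Finset.mem_coe.2 (Finset.mem_image.2 ⟨(u, b), hb.1, rfl⟩)

/-! ### K** — the kill of Piece A at three pages: LAYOUT IN KERNEL, robustness pencil
(brief `decomp-pnenp-lens-1/KSS-DoubleButterfly.md`).  Generic lemma: the push/pop matching of ANY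
stack trace is a pushdown family; the double reflected butterfly executed on one tape (TL, TR) and one
pushdown (S) is therefore an `H_3(10·M·L + 2M)` graph, `dbGraph L`.  Its ancestor-robustness
(`AncestorRobust 3 960 24`, brief §4) is the pencil part; `not_smallSegregators_of_dbRobust` is the hook. -/

/-- One stack operation per step. -/
inductive StackOp | push | pop | skip

/-- Decidable equality of stack operations, by cases (hand-written: no derived auxiliary lemmas). -/
instance instDecidableEqStackOp : DecidableEq StackOp := fun a b =>
  match a, b with
  | .push, .push => isTrue rfl
  | .pop, .pop => isTrue rfl
  | .skip, .skip => isTrue rfl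
  | .push, .pop => isFalse StackOp.noConfusion
  | .push, .skip => isFalse StackOp.noConfusion
  | .pop, .push => isFalse StackOp.noConfusion
  | .pop, .skip => isFalse StackOp.noConfusion
  | .skip, .push => isFalse StackOp.noConfusion
  | .skip, .pop => isFalse StackOp.noConfusion

open StackOp

/-- The `(push-step, pop-step)` arcs of a LIFO trace read from time `t` on, with pending push times
`st` (top first); a pop on an empty stack yields no arc (the machine reads a blank). -/
def lifoArcs : List StackOp → ℕ → List ℕ → Finset (ℕ × ℕ)
  | [], _, _ => ∅
  | push :: ops, t, st => lifoArcs ops (t + 1) (t :: st)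
  | pop :: ops, t, [] => lifoArcs ops (t + 1) []
  | pop :: ops, t, p :: st => insert (p, t) (lifoArcs ops (t + 1) st)
  | skip :: ops, t, st => lifoArcs ops (t + 1) st

/-- Three aligned stack traces of a common length `T`, plus the successor edges, give an
`H_3(T)` graph. -/
def traceGraph (T : ℕ) (τ₀ τ₁ τ₂ : List StackOp) : Finset (ℕ × ℕ) :=
  (Finset.range (T - 1)).image (fun t => (t, t + 1)) ∪
    (lifoArcs τ₀ 0 [] ∪ lifoArcs τ₁ 0 [] ∪ lifoArcs τ₂ 0 [])

/-! #### The double-butterfly schedule on one tape (TL, TR) and one pushdown (S) -/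

/-- `T(L) = 10·M·L + 2M`, `M = 2^L`. -/
def dbT (L : ℕ) : ℕ := 10 * 2 ^ L * L + 2 * 2 ^ L

/-! ### K** as a TWO-HYPOTHESIS KERNEL REDUCTION (0 sorry): charged path system + counting
The pencil proof of the brief factors through a machine-independent interface.  A CHARGED `DB(L)` PATH
SYSTEM in a step graph `E` on `[0,T)` assigns to every abstract vertex `(λ, x)` (`λ ≤ 2L`, `x < 2^L`) a
birth step and a finite set of carrier steps such that (path) whenever the birth, the carriers and the
target birth avoid `J`, the birth of `(λ, x)` is a `J`-avoiding ancestor of the birth of each of its two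
out-neighbours `(λ+1, x)`, `(λ+1, r_λ x)`, and (charge) every step is birth-or-carrier for at most `κ`
abstract vertices.  `DBCount κ` is the COUNTING LEMMA (pencil (B1)+(B2), pure finite combinatorics of the
reflected butterfly: blocked ≤ κ|J| ≤ M/16 ⟹ some top keeps ≥ (7/8)·M·L good lower vertices, whose
births are ≥ (7/8)ML/κ distinct avoiding ancestors); `DBLayout κ` says the schedule's step graph
`dbGraph L` carries such a system (κ = 5: verified mechanically for `L ≤ 8` by `kss/dbfly2.py`, pencil in
general).  KERNEL: the two together give `AncestorRobust 3 (160κ) (12κ)` — the budget arithmetic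
(`ell (dbT L) ≥ L + 4`, `|J| ≤ M/(16κ)`) and the final inequality are proved here — hence ¬A. -/

/-- Mirror partner of cell `x` at transition `λ → λ+1` of `DB(L)`: reflection inside its block of size
`2^(L - λ mod L)`. -/
def dbMirror (L lam x : ℕ) : ℕ :=
  2 * (x / 2 ^ (L - lam % L) * 2 ^ (L - lam % L)) + 2 ^ (L - lam % L) - 1 - x

/-- A charged `DB(L)` path system with charge `κ` in the step graph `E` on `[0, T)`. -/
structure ChargedDB (L T κ : ℕ) (E : Finset (ℕ × ℕ)) where
  /-- birth step of the abstract vertex `(λ, x)` -/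
  β : ℕ → ℕ → ℕ
  /-- carrier steps of the value of `(λ, x)` on its way to the births of its two out-neighbours -/
  carrier : ℕ → ℕ → Finset ℕ
  β_lt : ∀ lam x, lam ≤ 2 * L → x < 2 ^ L → β lam x < T
  path : ∀ lam x y, lam < 2 * L → x < 2 ^ L → (y = x ∨ y = dbMirror L lam x) →
    ∀ J : Finset ℕ, β lam x ∉ J → (∀ t ∈ carrier lam x, t ∉ J) → β (lam + 1) y ∉ J →
      β lam x ∈ ancestorsAvoiding E J (β (lam + 1) y)
  charge : ∀ t, (((Finset.range (2 * L + 1)) ×ˢ (Finset.range (2 ^ L))).filter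
      (fun p => t = β p.1 p.2 ∨ t ∈ carrier p.1 p.2)).card ≤ κ

/-- COUNTING LEMMA of K** (pencil, brief §4 (B1)+(B2); the disprover's `stub_count`): in ANY step graph
with a charged `DB(L)` path system, a deletion set of size ≤ `M/(16κ)` leaves a top birth with at least
`(7/8)·M·L/κ` avoiding ancestors. -/
def DBCount (κ : ℕ) : Prop :=
  ∀ (L T : ℕ) (E : Finset (ℕ × ℕ)) (D : ChargedDB L T κ E) (J : Finset ℕ), 5 ≤ L →
    16 * κ * J.card ≤ 2 ^ L → ∃ o, o < 2 ^ L ∧ D.β (2 * L) o ∉ J ∧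
      7 * 2 ^ L * L ≤ 8 * κ * (ancestorsAvoiding E J (D.β (2 * L) o)).ncard

section KSSCount

open Finset

section Mirror

variable {L lam x : ℕ}

end Mirror

/-! #### Blocked vertices, the good sets `G o d` (level `2L - d`), and the counting -/

section Count

variable {L T κ : ℕ} {E : Finset (ℕ × ℕ)} (D : ChargedDB L T κ E) (J : Finset ℕ)

/-- `(lam, z)` is blocked by `J`: its birth or one of its carriers lies in `J`. -/
def blocked (lam z : ℕ) : Prop := D.β lam z ∈ J ∨ (D.carrier lam z ∩ J).Nonempty

/-- K\*\* cone (auxiliary instance): `instDecBlocked`. -/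
instance instDecBlocked (lam z : ℕ) : Decidable (blocked D J lam z) := by
  unfold blocked; infer_instance

/-- blocked vertices of level `lam` -/
def Bl (lam : ℕ) : Finset ℕ := (range (2 ^ L)).filter (fun z => blocked D J lam z)

/-- all blocked abstract vertices -/
def Bltot : Finset (ℕ × ℕ) :=
  ((range (2 * L + 1)) ×ˢ (range (2 ^ L))).filter (fun p => blocked D J p.1 p.2)

/-- The good sets: `G o d` ⊆ level `2L - d`; unblocked vertices with an unblocked route to the top `o`. -/
def G (o : ℕ) : ℕ → Finset ℕ
  | 0 => (range (2 ^ L)).filter (fun z => ¬ blocked D J (2 * L) z ∧ z = o)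
  | d + 1 => (range (2 ^ L)).filter (fun z => ¬ blocked D J (2 * L - (d + 1)) z ∧
      (z ∈ G o d ∨ dbMirror L (2 * L - (d + 1)) z ∈ G o d))

variable {D J}

/-- Partial sums of blocked levels from the top: `S d = Σ_{j ≤ d} |Bl (2L - j)|`. -/
def Sbl (d : ℕ) : ℕ := ∑ j ∈ range (d + 1), (Bl D J (2 * L - j)).card

/-- Potential of the funnel: `Φ d = Σ_o |G o d|`. -/
def Phi (d : ℕ) : ℕ := ∑ o ∈ range (2 ^ L), (G D J o d).card

end Count

section Final

variable {L T κ : ℕ} {E : Finset (ℕ × ℕ)} {D : ChargedDB L T κ E} {J : Finset ℕ}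

end Final

end KSSCount

namespace TSB

/-! #### Generic LIFO toolkit: final stack, append, prefix-balance, matching -/

/-- The stack left by running `ops` from time `t` on stack `st`. -/
def lifoStack : List StackOp → ℕ → List ℕ → List ℕ
  | [], _, st => st
  | push :: ops, t, st => lifoStack ops (t + 1) (t :: st)
  | pop :: ops, t, [] => lifoStack ops (t + 1) []
  | pop :: ops, t, _ :: st => lifoStack ops (t + 1) st
  | skip :: ops, t, st => lifoStack ops (t + 1) st

/-- Prefix discipline: no prefix of `l` pops more than it pushed plus `d`. -/
def PD (d : ℕ) (l : List StackOp) : Prop :=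
  ∀ n, (l.take n).count pop ≤ (l.take n).count push + d

/-! ### The triple-stack butterfly schedule

Three stacks `U`, `A`, `B`.  Level `lam < 2L` has block size `B = 2^(L - lam % L)` and `2^(lam % L)` blocks;
each block is three phases of `B` steps: P (pop the block's `B` input tokens from the IN stack, push each on
`U` and on the V stack), Q (pop V, push IN), C (pop `U` and IN: the two tokens `x`, `mirror x` meet; the
vertex `(lam+1, x)` is born and pushed on V).  IN/V roles of `A`, `B` alternate with the parity of `lam`
(`A` is IN at even levels; the initial `2^L` pushes go to `A`).  Processing order of a level: descending in
`x` at even levels, ascending at odd ones (a stack reverses the order between levels). -/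

section Schedule

/-- K\*\* cone (auxiliary definition): `bsz`. -/
def bsz (L lam : ℕ) : ℕ := 2 ^ (L - lam % L)

/-- K\*\* cone (auxiliary definition): `nblk`. -/
def nblk (L lam : ℕ) : ℕ := 2 ^ (lam % L)

/-- K\*\* cone (auxiliary definition): `blkU`. -/
def blkU (B : ℕ) : List StackOp := List.replicate B push ++ List.replicate B skip ++ List.replicate B pop

/-- K\*\* cone (auxiliary definition): `blkV`. -/
def blkV (B : ℕ) : List StackOp := List.replicate B push ++ List.replicate B pop ++ List.replicate B push

/-- K\*\* cone (auxiliary definition): `blkI`. -/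
def blkI (B : ℕ) : List StackOp := List.replicate B pop ++ List.replicate B push ++ List.replicate B pop

/-- K\*\* cone (auxiliary definition): `levU`. -/
def levU (L lam : ℕ) : List StackOp := (List.replicate (nblk L lam) (blkU (bsz L lam))).flatten

/-- K\*\* cone (auxiliary definition): `levV`. -/
def levV (L lam : ℕ) : List StackOp := (List.replicate (nblk L lam) (blkV (bsz L lam))).flatten

/-- K\*\* cone (auxiliary definition): `levI`. -/
def levI (L lam : ℕ) : List StackOp := (List.replicate (nblk L lam) (blkI (bsz L lam))).flatten

/-- K\*\* cone (auxiliary definition): `levX`. -/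
def levX (L par lam : ℕ) : List StackOp := if lam % 2 = par then levI L lam else levV L lam

/-- K\*\* cone (auxiliary definition): `padLen`. -/
def padLen (L : ℕ) : ℕ := dbT L - (2 ^ L + 6 * 2 ^ L * L)

/-- K\*\* cone (auxiliary definition): `initX`. -/
def initX (L par : ℕ) : List StackOp :=
  if par = 0 then List.replicate (2 ^ L) push else List.replicate (2 ^ L) skip

/-- K\*\* cone (auxiliary definition): `trU`. -/
def trU (L : ℕ) : List StackOp :=
  List.replicate (2 ^ L) skip ++ ((List.range (2 * L)).map (levU L)).flatten ++
    List.replicate (padLen L) skip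

/-- K\*\* cone (auxiliary definition): `trX`. -/
def trX (L par : ℕ) : List StackOp :=
  initX L par ++ ((List.range (2 * L)).map (levX L par)).flatten ++ List.replicate (padLen L) skip

/-! #### Times -/

/-- K\*\* cone (auxiliary definition): `base`. -/
def base (L lam : ℕ) : ℕ := 2 ^ L + 3 * 2 ^ L * lam

/-- position of `x` in the processing order of level `lam` (an involution of `[0, 2^L)`). -/
def posOf (L lam x : ℕ) : ℕ := if lam % 2 = 0 then 2 ^ L - 1 - x else x

/-- P-step, Q-step, C-step (birth of `(lam+1, x)`) and the partner C-step of token `x` at level `lam`. -/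
def tP (L lam x : ℕ) : ℕ :=
  base L lam + 3 * bsz L lam * (posOf L lam x / bsz L lam) + posOf L lam x % bsz L lam

/-- K\*\* cone (auxiliary definition): `tQ`. -/
def tQ (L lam x : ℕ) : ℕ :=
  base L lam + 3 * bsz L lam * (posOf L lam x / bsz L lam) + bsz L lam +
    (bsz L lam - 1 - posOf L lam x % bsz L lam)

/-- K\*\* cone (auxiliary definition): `tC`. -/
def tC (L lam x : ℕ) : ℕ :=
  base L lam + 3 * bsz L lam * (posOf L lam x / bsz L lam) + 2 * bsz L lam + posOf L lam x % bsz L lam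

/-- K\*\* cone (auxiliary definition): `tC'`. -/
def tC' (L lam x : ℕ) : ℕ :=
  base L lam + 3 * bsz L lam * (posOf L lam x / bsz L lam) + 2 * bsz L lam +
    (bsz L lam - 1 - posOf L lam x % bsz L lam)

/-- births: the initial pushes for level 0, the C-steps of level `lam - 1` otherwise. -/
def beta (L lam x : ℕ) : ℕ := if lam = 0 then x else tC L (lam - 1) x

end Schedule

section Arcs

variable {L : ℕ}

end Arcs

section MirrorCopy

variable {L lam x : ℕ}

variable {L lam x : ℕ}

end MirrorCopy

section TokenArcs

variable {L : ℕ}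

end TokenArcs

/-! ### The charged `DB(L)` system of the schedule (charge 1) -/

section Layout

open Relation

/-- The step graph of the triple-stack butterfly schedule. -/
def tbGraph (L : ℕ) : Finset (ℕ × ℕ) := traceGraph (dbT L) (trU L) (trX L 0) (trX L 1)

/-- K\*\* cone (auxiliary definition): `carrier`. -/
def carrier (L lam x : ℕ) : Finset ℕ := {tP L lam x, tQ L lam x}

variable {L : ℕ}

/-! #### Decoding a step to the unique abstract vertex charged to it -/

/-- K\*\* cone (auxiliary definition): `decodeAux`. -/
def decodeAux (L lam rr : ℕ) : ℕ × ℕ :=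
  if rr % (3 * bsz L lam) / bsz L lam = 0 then
    (lam, posOf L lam (rr / (3 * bsz L lam) * bsz L lam + rr % (3 * bsz L lam) % bsz L lam))
  else if rr % (3 * bsz L lam) / bsz L lam = 1 then
    (lam, posOf L lam (rr / (3 * bsz L lam) * bsz L lam +
      (bsz L lam - 1 - rr % (3 * bsz L lam) % bsz L lam)))
  else (lam + 1, posOf L lam (rr / (3 * bsz L lam) * bsz L lam + rr % (3 * bsz L lam) % bsz L lam))

/-- K\*\* cone (auxiliary definition): `decode`. -/
def decode (L t : ℕ) : ℕ × ℕ :=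
  if t < 2 ^ L then (0, t) else decodeAux L ((t - 2 ^ L) / (3 * 2 ^ L)) ((t - 2 ^ L) % (3 * 2 ^ L))

end Layout

end TSB

/-! #### K\*\* assembled: `¬ SmallSegregators`, unconditionally -/

/-- Layout statement over an arbitrary `H_3(dbT L)` step graph (generalises `DBLayout`). -/
def DBLayoutIn (κ : ℕ) : Prop :=
  ∀ L, 5 ≤ L → ∃ E, IsMultiPushdownGraph 3 (dbT L) E ∧ Nonempty (ChargedDB L (dbT L) κ E)

end Summit.PneNP.PneNP.Theorems.RootDecompSegregatorSmallSegregators.Negative
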